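import Mathlib
import HarnessLib
import Literature.MathematicalPhysics.QuantumLattice.HubbardTwoPointSimplexMatch

/-!
# Child `KLRegimeVolumeLimitV12` (stmt-HubbardSuperconductivity-19858), `stub_vl_bound` via (H1): the GENERAL ENTRY DICTIONARY — the limiting
# Grassmann entry at ANY non-zero time difference `d ∈ ℝ` is a free two-time Fermi-matrix entry at ANY operator times `S, T` with `S − T = −d`
# (seat hubbard-kl-k3c4-p2, g3; «Matsubara all-U route (R-a)»; companion of k3c5-p1's order-zero anchor `vertexLimitEntry_neg_eq_fermiMatrix_entry`)

For the τ-resolved identification (H1) (HOME/hubbard-kl-k3c5-p1/H1-DESIGN.md §2 C3) every entry of the Grassmann limit matrix,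
`vertexLimitEntry L β μ x̄ ȳ ς ς′ d` at the time difference `d = T_b − T_a` of an annihilation leg `(ȳ, ς′)` (Grassmann time `T_b`) against a
creation leg `(x̄, ς)` (Grassmann time `T_a`), must be matched with an entry of the split-pair word matrix (C2), i.e. with one of the two closed
Fermi-matrix forms of the free two-time correlations of `dΓ(h)`, `h = hubbardOneBody (torus) 1 μ` (`gibbsState_dGamma_prod_evolved_eq_det`):
creation BEFORE annihilation `⟨a⁺_{x̄ς}(S) a⁻_{ȳς′}(T)⟩ = [e^{−Th}(1+e^{βh})⁻¹e^{Sh}]_{(ȳς′),(x̄ς)}`, or annihilation before creation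
`−⟨a⁻_{ȳς′}(T) a⁺_{x̄ς}(S)⟩ = −[e^{−Th}(1+e^{−βh})⁻¹e^{Sh}]_{(ȳς′),(x̄ς)}`.  Both depend on `(S, T)` only through `S − T`, and the dictionary is:

* **`vertexLimitEntry_eq_fermiMatrix_entry_of_neg`** — `d < 0`, any `S, T` with `S − T = −d`:
  `vertexLimitEntry L β μ x̄ ȳ ς ς′ d = [e^{−Th}(1+e^{βh})⁻¹e^{Sh}]_{(ȳς′),(x̄ς)}` (the `−n_F e^{−ξd}` branch; k3c5-p1's anchor is `d = 0 − s`,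
  `S = s`, `T = 0`);
* **`vertexLimitEntry_eq_neg_fermiMatrix_entry_of_pos`** — `0 < d`, any `S, T` with `S − T = −d`:
  `vertexLimitEntry L β μ x̄ ȳ ς ς′ d = −[e^{−Th}(1+e^{−βh})⁻¹e^{Sh}]_{(ȳς′),(x̄ς)}` (the `(1−n_F)e^{−ξd}` branch).

So on the open marked pieces (all time differences non-zero) the X-row / vertex entries (no KMS flip: `S, T` = the operator times themselves)
and the Y-column entries (KMS flip = the same formulas read with `T = 0` and `S` = the Grassmann time of the creation leg, as in the anchor) are
ALL instances of these two lemmas; the signs relative to the before-rule of the interleaved word are then pure bookkeeping (C2's `ε`).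
Everything is proved; no definition.
-/

noncomputable section

namespace Summit.HubbardSuperconductivity.HubbardSuperconductivity.Theorems.MatsubaraAllU

set_option linter.dupNamespace false -- summit = problem name (single-conjunct summit), D-0017

open Finset NormedSpace Literature.MathematicalPhysics.QuantumLattice Literature.Probability.LatticeModels

variable {L : ℕ} [NeZero L]

/-- **Dictionary, negative time difference** (`L ≥ 3`): for `d < 0` and any real operator times `S, T` with `S − T = −d`,
`vertexLimitEntry L β μ x̄ ȳ ς ς′ d = [e^{−Th}(1 + e^{βh})⁻¹ e^{Sh}]_{(ȳς′),(x̄ς)}`, `h = hubbardOneBody (fermionTorusGraph 2 L) 1 μ` — the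
creation-before-annihilation free two-time correlation `⟨a⁺_{x̄ς}(S) a⁻_{ȳς′}(T)⟩_{β,dΓ(h)}`. -/
theorem vertexLimitEntry_eq_fermiMatrix_entry_of_neg (hL : 3 ≤ L) (β μ : ℝ) (ς ς' : Fin 2) (xe ye : TorusSite 2 L) {d : ℝ} (hd : d < 0)
    (S T : ℝ) (hST : S - T = -d) :
    vertexLimitEntry L β μ xe ye ς ς' d =
      (exp (-((T : ℂ) • hubbardOneBody (fermionTorusGraph 2 L) 1 μ)) *
          (1 + exp ((β : ℂ) • hubbardOneBody (fermionTorusGraph 2 L) 1 μ))⁻¹ *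
          exp ((S : ℂ) • hubbardOneBody (fermionTorusGraph 2 L) 1 μ))
        (orb (FermionTorus.ofTorusSite ye) ς') (orb (FermionTorus.ofTorusSite xe) ς) := by
  -- the right-hand side is the `a ≤ b` entry of a two-pair propagator matrix: pair 0 = (x̄ς) at time `S`, pair 1 = (ȳς′) at time `T`
  have hprop := propMatrix_torus_orb_apply₂ hL β μ (N := 2)
    (![FermionTorus.ofTorusSite xe, FermionTorus.ofTorusSite ye]) (![FermionTorus.ofTorusSite xe, FermionTorus.ofTorusSite ye])
    (![ς, ς']) (![ς, ς']) (![(S : ℂ), (T : ℂ)]) 0 1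
  simp only [propMatrix, Matrix.of_apply, Fin.zero_le, if_true, Matrix.cons_val_zero, Matrix.cons_val_one,
    FermionTorus.toTorusSite_ofTorusSite] at hprop
  rw [hprop, vertexLimitEntry_eq_torusChar]
  have hL2 : ((1 / (L : ℝ) ^ 2 : ℝ) : ℂ) = ((L : ℂ) ^ 2)⁻¹ := by push_cast; rw [one_div]
  by_cases hσ : ς = ς'
  · subst hσ
    rw [if_pos rfl, if_pos rfl, hL2, show xe - ye = -(ye - xe) by abel,
      sum_torusChar_neg_of_even _ _ (fun q => by simp only [nambuXi, torusBand_neg]), ← mul_neg, ← Finset.sum_neg_distrib]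
    refine congrArg _ (sum_congr rfl fun q _ => ?_)
    rw [← mul_neg]
    refine congrArg _ ?_
    -- scalar match: `−G_β(ξ, d) = e^{−dξ} f_β(ξ)` for `d < 0`, and `S − T = −d`
    rw [timeOrderedPropagator_of_neg β (nambuXi L μ q) hd, nambuXi, fermiFunction]
    have hTS : (T : ℂ) - (S : ℂ) = (d : ℂ) := by
      rw [← Complex.ofReal_sub]; exact congrArg _ (by linarith)
    rw [hTS]
    push_cast
    rw [neg_neg, one_div, mul_comm]
    congr 2
    ring
  · rw [if_neg hσ, if_neg (Ne.symm hσ), neg_zero]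

/-- **Dictionary, positive time difference** (`L ≥ 3`): for `0 < d` and any real operator times `S, T` with `S − T = −d`,
`vertexLimitEntry L β μ x̄ ȳ ς ς′ d = −[e^{−Th}(1 + e^{−βh})⁻¹ e^{Sh}]_{(ȳς′),(x̄ς)}` — minus the annihilation-before-creation free two-time
correlation `⟨a⁻_{ȳς′}(T) a⁺_{x̄ς}(S)⟩_{β,dΓ(h)}`. -/
theorem vertexLimitEntry_eq_neg_fermiMatrix_entry_of_pos (hL : 3 ≤ L) (β μ : ℝ) (ς ς' : Fin 2) (xe ye : TorusSite 2 L) {d : ℝ}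
    (hd : 0 < d) (S T : ℝ) (hST : S - T = -d) :
    vertexLimitEntry L β μ xe ye ς ς' d =
      -(exp (-((T : ℂ) • hubbardOneBody (fermionTorusGraph 2 L) 1 μ)) *
          (1 + exp (-((β : ℂ) • hubbardOneBody (fermionTorusGraph 2 L) 1 μ)))⁻¹ *
          exp ((S : ℂ) • hubbardOneBody (fermionTorusGraph 2 L) 1 μ))
        (orb (FermionTorus.ofTorusSite ye) ς') (orb (FermionTorus.ofTorusSite xe) ς) := by
  -- the right-hand side is the `a > b` entry of a two-pair propagator matrix: pair 0 = (ȳς′) at time `T`, pair 1 = (x̄ς) at time `S`,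
  -- read at (row 1 = creation of pair 1, column 0 = annihilation of pair 0)
  have hprop := propMatrix_torus_orb_apply₂ hL β μ (N := 2)
    (![FermionTorus.ofTorusSite ye, FermionTorus.ofTorusSite xe]) (![FermionTorus.ofTorusSite ye, FermionTorus.ofTorusSite xe])
    (![ς', ς]) (![ς', ς]) (![(T : ℂ), (S : ℂ)]) 1 0
  have h10 : ¬ ((1 : Fin 2) ≤ 0) := by decide
  simp only [propMatrix, Matrix.of_apply, h10, if_false, Matrix.cons_val_zero, Matrix.cons_val_one,
    FermionTorus.toTorusSite_ofTorusSite] at hprop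
  rw [hprop, vertexLimitEntry_eq_torusChar]
  have hL2 : ((1 / (L : ℝ) ^ 2 : ℝ) : ℂ) = ((L : ℂ) ^ 2)⁻¹ := by push_cast; rw [one_div]
  congr 1
  by_cases hσ : ς = ς'
  · subst hσ
    rw [if_pos rfl, if_pos rfl, hL2, show xe - ye = -(ye - xe) by abel,
      sum_torusChar_neg_of_even _ _ (fun q => by simp only [nambuXi, torusBand_neg])]
    refine congrArg _ (sum_congr rfl fun q _ => ?_)
    refine congrArg _ ?_
    -- scalar match: `G_β(ξ, d) = e^{−dξ} f_{−β}(ξ)` for `0 < d`, and `S − T = −d`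
    rw [timeOrderedPropagator_of_pos β (nambuXi L μ q) hd, nambuXi, fermiFunction]
    have hTS : (T : ℂ) - (S : ℂ) = (d : ℂ) := by
      rw [← Complex.ofReal_sub]; exact congrArg _ (by linarith)
    rw [hTS]
    push_cast
    rw [one_div, mul_comm]
    congr 2 <;> ring
  · rw [if_neg hσ, if_neg (Ne.symm hσ)]

/-- **Dictionary, negative time difference, COMPLEX operator times** (`L ≥ 3`): for `d < 0` and any `S, T : ℂ` with `S − T = −d`
(e.g. `S = u·(−β)`, `T = ((β−s)/β + u′)·(−β)` as they appear in the two-time Dyson integrand),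
`vertexLimitEntry L β μ x̄ ȳ ς ς′ d = [e^{−Th}(1 + e^{βh})⁻¹ e^{Sh}]_{(ȳς′),(x̄ς)}`. -/
theorem vertexLimitEntry_eq_fermiMatrix_entry_of_neg' (hL : 3 ≤ L) (β μ : ℝ) (ς ς' : Fin 2) (xe ye : TorusSite 2 L) {d : ℝ} (hd : d < 0)
    (S T : ℂ) (hST : S - T = -(d : ℂ)) :
    vertexLimitEntry L β μ xe ye ς ς' d =
      (exp (-(T • hubbardOneBody (fermionTorusGraph 2 L) 1 μ)) *
          (1 + exp ((β : ℂ) • hubbardOneBody (fermionTorusGraph 2 L) 1 μ))⁻¹ *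
          exp (S • hubbardOneBody (fermionTorusGraph 2 L) 1 μ))
        (orb (FermionTorus.ofTorusSite ye) ς') (orb (FermionTorus.ofTorusSite xe) ς) := by
  have hprop := propMatrix_torus_orb_apply₂ hL β μ (N := 2)
    (![FermionTorus.ofTorusSite xe, FermionTorus.ofTorusSite ye]) (![FermionTorus.ofTorusSite xe, FermionTorus.ofTorusSite ye])
    (![ς, ς']) (![ς, ς']) (![S, T]) 0 1
  simp only [propMatrix, Matrix.of_apply, Fin.zero_le, if_true, Matrix.cons_val_zero, Matrix.cons_val_one,
    FermionTorus.toTorusSite_ofTorusSite] at hprop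
  rw [hprop, vertexLimitEntry_eq_torusChar]
  have hL2 : ((1 / (L : ℝ) ^ 2 : ℝ) : ℂ) = ((L : ℂ) ^ 2)⁻¹ := by push_cast; rw [one_div]
  have hTS : T - S = (d : ℂ) := by linear_combination -hST
  by_cases hσ : ς = ς'
  · subst hσ
    rw [if_pos rfl, if_pos rfl, hL2, show xe - ye = -(ye - xe) by abel,
      sum_torusChar_neg_of_even _ _ (fun q => by simp only [nambuXi, torusBand_neg]), ← mul_neg, ← Finset.sum_neg_distrib]
    refine congrArg _ (sum_congr rfl fun q _ => ?_)
    rw [← mul_neg]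
    refine congrArg _ ?_
    rw [timeOrderedPropagator_of_neg β (nambuXi L μ q) hd, nambuXi, fermiFunction, hTS]
    push_cast
    rw [neg_neg, one_div, mul_comm]
    congr 2
    ring
  · rw [if_neg hσ, if_neg (Ne.symm hσ), neg_zero]

/-- **Dictionary, positive time difference, COMPLEX operator times** (`L ≥ 3`): for `0 < d` and any `S, T : ℂ` with `S − T = −d`,
`vertexLimitEntry L β μ x̄ ȳ ς ς′ d = −[e^{−Th}(1 + e^{−βh})⁻¹ e^{Sh}]_{(ȳς′),(x̄ς)}`. -/
theorem vertexLimitEntry_eq_neg_fermiMatrix_entry_of_pos' (hL : 3 ≤ L) (β μ : ℝ) (ς ς' : Fin 2) (xe ye : TorusSite 2 L) {d : ℝ}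
    (hd : 0 < d) (S T : ℂ) (hST : S - T = -(d : ℂ)) :
    vertexLimitEntry L β μ xe ye ς ς' d =
      -(exp (-(T • hubbardOneBody (fermionTorusGraph 2 L) 1 μ)) *
          (1 + exp (-((β : ℂ) • hubbardOneBody (fermionTorusGraph 2 L) 1 μ)))⁻¹ *
          exp (S • hubbardOneBody (fermionTorusGraph 2 L) 1 μ))
        (orb (FermionTorus.ofTorusSite ye) ς') (orb (FermionTorus.ofTorusSite xe) ς) := by
  have hprop := propMatrix_torus_orb_apply₂ hL β μ (N := 2)
    (![FermionTorus.ofTorusSite ye, FermionTorus.ofTorusSite xe]) (![FermionTorus.ofTorusSite ye, FermionTorus.ofTorusSite xe])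
    (![ς', ς]) (![ς', ς]) (![T, S]) 1 0
  have h10 : ¬ ((1 : Fin 2) ≤ 0) := by decide
  simp only [propMatrix, Matrix.of_apply, h10, if_false, Matrix.cons_val_zero, Matrix.cons_val_one,
    FermionTorus.toTorusSite_ofTorusSite] at hprop
  rw [hprop, vertexLimitEntry_eq_torusChar]
  have hL2 : ((1 / (L : ℝ) ^ 2 : ℝ) : ℂ) = ((L : ℂ) ^ 2)⁻¹ := by push_cast; rw [one_div]
  have hTS : T - S = (d : ℂ) := by linear_combination -hST
  congr 1
  by_cases hσ : ς = ς'
  · subst hσ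
    rw [if_pos rfl, if_pos rfl, hL2, show xe - ye = -(ye - xe) by abel,
      sum_torusChar_neg_of_even _ _ (fun q => by simp only [nambuXi, torusBand_neg])]
    refine congrArg _ (sum_congr rfl fun q _ => ?_)
    refine congrArg _ ?_
    rw [timeOrderedPropagator_of_pos β (nambuXi L μ q) hd, nambuXi, fermiFunction, hTS]
    push_cast
    rw [one_div, mul_comm]
    congr 2 <;> ring
  · rw [if_neg hσ, if_neg (Ne.symm hσ)]

/-- **Dictionary, KMS-shifted, negative time difference** (`L ≥ 3`): for `d < 0` and any `S, T : ℂ` with `S − T = −d − β` (a creation leg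
read one period EARLIER, e.g. the operator time `T_a − β` of a Grassmann leg at `T_a` against `Y` at operator time `0`):
`vertexLimitEntry L β μ x̄ ȳ ς ς′ d = [e^{−Th}(1 + e^{−βh})⁻¹ e^{Sh}]_{(ȳς′),(x̄ς)}` — the annihilation-before-creation form WITHOUT its minus
(so the before-rule entry `−⟨a⁻_Y(T) a⁺(S)⟩` of a word with `Y` first is `−vertexLimitEntry`: the KMS sign `ε = −1` of the `Y` column). -/
theorem vertexLimitEntry_eq_fermiMatrix_entry_of_neg_kms (hL : 3 ≤ L) (β μ : ℝ) (ς ς' : Fin 2) (xe ye : TorusSite 2 L) {d : ℝ}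
    (hd : d < 0) (S T : ℂ) (hST : S - T = -(d : ℂ) - (β : ℂ)) :
    vertexLimitEntry L β μ xe ye ς ς' d =
      (exp (-(T • hubbardOneBody (fermionTorusGraph 2 L) 1 μ)) *
          (1 + exp (-((β : ℂ) • hubbardOneBody (fermionTorusGraph 2 L) 1 μ)))⁻¹ *
          exp (S • hubbardOneBody (fermionTorusGraph 2 L) 1 μ))
        (orb (FermionTorus.ofTorusSite ye) ς') (orb (FermionTorus.ofTorusSite xe) ς) := by
  have hprop := propMatrix_torus_orb_apply₂ hL β μ (N := 2)
    (![FermionTorus.ofTorusSite ye, FermionTorus.ofTorusSite xe]) (![FermionTorus.ofTorusSite ye, FermionTorus.ofTorusSite xe])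
    (![ς', ς]) (![ς', ς]) (![T, S]) 1 0
  have h10 : ¬ ((1 : Fin 2) ≤ 0) := by decide
  simp only [propMatrix, Matrix.of_apply, h10, if_false, Matrix.cons_val_zero, Matrix.cons_val_one,
    FermionTorus.toTorusSite_ofTorusSite, neg_inj] at hprop
  rw [hprop, vertexLimitEntry_eq_torusChar]
  have hL2 : ((1 / (L : ℝ) ^ 2 : ℝ) : ℂ) = ((L : ℂ) ^ 2)⁻¹ := by push_cast; rw [one_div]
  have hTS : T - S = (d : ℂ) + (β : ℂ) := by linear_combination -hST
  by_cases hσ : ς = ς'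
  · subst hσ
    rw [if_pos rfl, if_pos rfl, hL2, show xe - ye = -(ye - xe) by abel,
      sum_torusChar_neg_of_even _ _ (fun q => by simp only [nambuXi, torusBand_neg]), ← mul_neg, ← Finset.sum_neg_distrib]
    refine congrArg _ (sum_congr rfl fun q _ => ?_)
    rw [← mul_neg]
    refine congrArg _ ?_
    rw [timeOrderedPropagator_of_neg β (nambuXi L μ q) hd, nambuXi, fermiFunction, hTS]
    -- a REAL identity: `(1+e^{βr})⁻¹ e^{−rd} = e^{−(d+β)r} · 1/(1+e^{−βr})`
    set r : ℝ := torusBand L q - μ with hr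
    have hreal : (1 + Real.exp (β * r))⁻¹ * Real.exp (-(r * d)) = Real.exp (-(d + β) * r) * (1 / (1 + Real.exp (-β * r))) := by
      have h1 : Real.exp (-(d + β) * r) = Real.exp (-(r * d)) * (Real.exp (β * r))⁻¹ := by
        rw [← Real.exp_neg, ← Real.exp_add]; ring_nf
      have h2 : Real.exp (-β * r) = (Real.exp (β * r))⁻¹ := by rw [← Real.exp_neg]; ring_nf
      rw [h1, h2]
      have hpos : 0 < Real.exp (β * r) := Real.exp_pos _
      field_simp
      ring
    have hcast : Complex.exp (-((d : ℂ) + (β : ℂ)) * ((r : ℝ) : ℂ)) = ((Real.exp (-(d + β) * r) : ℝ) : ℂ) := by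
      rw [Complex.ofReal_exp]; push_cast; ring_nf
    rw [hcast]
    push_cast
    rw [neg_neg]
    have := congrArg (fun t : ℝ => (t : ℂ)) hreal
    push_cast at this
    exact this
  · rw [if_neg hσ, if_neg (Ne.symm hσ), neg_zero]

end Summit.HubbardSuperconductivity.HubbardSuperconductivity.Theorems.MatsubaraAllU

end
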